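import Mathlib.Data.Rat.Defs
import Mathlib.Data.Finset.Basic
import Mathlib.Algebra.BigOperators.Group.List.Basic
import Mathlib.Tactic.Linarith
import Mathlib.Tactic.NormNum
import Mathlib.Tactic.IntervalCases
import Mathlib.Tactic.Positivity
import Mathlib.Tactic.Ring
import HarnessLib

/-!
# The point census at `(p, ρ) = (5, 1/28)` (T33: suppliers and active sets of LEMMA F-DENSE₂₈(5))

Uniform value line: INSTRUMENT — kernel-checked WEIGHT ARITHMETIC for the polynomial
weighted-centre model `W(f)` of the cell (engine 1's toy model: THEOREM-FS-eng1-g35 §11.3 LEMMA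
F-DENSE₂₈(5), census tool `pt28.py` PART 2 (a)–(b); CARVER-NOTES-eng1-g35 T33) — NOT a resolution
theorem, NOT a statement about the Abramovich–Temkin–Włodarczyk invariant, NOT summit progress;
AI-written Lean, AI review is weaker than expert review.

## Dictionary (weights in units of `ρ = 1/28`, i.e. multiplied by `28`; rationals)

* legal slot weights: `Legal w := (0 < w ∧ w ≤ 28/5) ∨ w ∈ U`, `U = {35/6, 56/9, 7, 28/3, 14}`
  (`= 5/24, 2/9, 1/4, 1/3, 1/2`: the classes `N, N', W, M, V`); "dense" = the first alternative.
* `T`-variables (variables of weight `≥ u = 5ρ = 5/28`): `TWt x := Dense x ∨ x ∈ U` with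
  `Dense x := 5 ≤ x ≤ 28/5` — a CONTINUUM of dense weights, handled symbolically (`x`, `x'` below),
  exactly as in `pt28` ("dense parts symbolic").
* a SUPPLIER of order `s` (`1 ≤ s ≤ p = 5`) with output group `κ` (`≤ 3` `T`-parts) sits in a
  slot of weight `w = wt κ + s` which must be legal.  The pure `σ⁵`-class `F` weighs `5`
  (dense); `x₄₇ = 47/9`, `x₁₆ = 16/3`, `x₃₁ = 31/6` are the named dense weights of §11.3.
* an ACTIVE SET is a multiset of member kinds (the supplier kinds and the unrectified pure class
  `a₁` of order `4`, weight `4`) with orders summing to `p = 5`, at least one impure member, and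
  kept weight `28 − Σ (member weights)` representable as a sum of `T`-weights (`Representable`).

## Content (§11.3 SUPPLIERS / ACTIVE SETS, re-derived here)

* PART 2(a): `onePart_census` — a one-part supplier `x + s` is legal iff `(s, x) ∈ {(1, 47/9),
  (2, 5), (4, 16/3)}` (`N'(1;x₄₇)`, `W(2;F)`, `M(4;x₁₆)`); `legal_twoParts_iff` + `pairSum_census` —
  a two-part supplier `x + y + s` is legal iff `x + y + s = 14` (a `V`-slot), and the pair sums
  `13, 12, 11, 10, 9` are realised by: nothing; `{5, 7}` (`V(2;FW)`); `{x, 11 − x}` with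
  `27/5 ≤ x ≤ 11/2` or `{31/6, 35/6}` (`V(3;xx')`, `V(3;N x₃₁)`); `{5, 5}` (`V(4;FF)`); nothing —
  in particular NO supplier of order `5`; `not_legal_threeParts` — no supplier has `≥ 3` parts.
* PART 2(b): over the eight member kinds, the `15` multisets with order sum `5` (`candidates_eq`,
  all contain an impure member), and `active_census`: the kept weight is representable iff the
  multiset is one of the SIX active sets `{W(2;F), V(3;·)} ×2, {V(2;FW), V(3;·)} ×2,
  {N'(1;x₄₇), M(4;x₁₆)}, {N'(1;x₄₇), a₁}` (the others leave `70/9`, a weight in `(0, 5)`, or a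
  negative weight); `factA` — every active set contains one of the CLEAN kinds
  `N'(1;x₄₇), W(2;F), V(2;FW)`.

Not here: the kill readings (LEMMA CS, `N_W`, LEMMA N, `N_{N'}`) — see the companion identity
files; the emission rules themselves (which `κ` a slot class can emit) are taken as the
definition of "supplier", as in `pt28`.

References (context only; elementary arithmetic decided here): [AbramovichTemkinWlodarczyk2024] §5
(weights of a weighted centre); [Wlodarczyk2022] (weighted centres in arbitrary characteristic).
-/

namespace Literature.AlgebraicGeometry.Resolution.WeightedBlowup

namespace Point28

/-! ## Legal weights and `T`-weights (units of `1/28`) -/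

/-- `U = {35/6, 56/9, 7, 28/3, 14}` (`= 28 · {5/24, 2/9, 1/4, 1/3, 1/2}`, LEMMA G).
[cite: AbramovichTemkinWlodarczyk2024, §5] -/
def U : Finset ℚ := {35/6, 56/9, 7, 28/3, 14}

/-- Legal slot weight (times `28`): dense `(0, 28/5]` or in `U`.
[cite: AbramovichTemkinWlodarczyk2024, §5] -/
def Legal (w : ℚ) : Prop := (0 < w ∧ w ≤ 28/5) ∨ w ∈ U

/-- `Legal` is decidable (closed checks by `decide`/`norm_num`). [folklore] instance plumbing;
context [cite: AbramovichTemkinWlodarczyk2024, §5]. -/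
instance instDecidablePredLegal : DecidablePred Legal :=
  fun _ => inferInstanceAs (Decidable ((_ ∧ _) ∨ _))

/-- Dense `T`-weight (times `28`): `5 ≤ x ≤ 28/5`, i.e. a dense variable of weight in
`[5ρ, 1/5]`. [cite: AbramovichTemkinWlodarczyk2024, §5] -/
def Dense (x : ℚ) : Prop := 5 ≤ x ∧ x ≤ 28/5

/-- `Dense` is decidable. [folklore] instance plumbing; context
[cite: AbramovichTemkinWlodarczyk2024, §5]. -/
instance instDecidablePredDense : DecidablePred Dense :=
  fun _ => inferInstanceAs (Decidable (_ ∧ _))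

/-- Weight of a `T`-variable (times `28`): dense in `[5, 28/5]` or in `U`.
[cite: AbramovichTemkinWlodarczyk2024, §5] -/
def TWt (x : ℚ) : Prop := Dense x ∨ x ∈ U

/-- `TWt` is decidable. [folklore] instance plumbing; context
[cite: AbramovichTemkinWlodarczyk2024, §5]. -/
instance instDecidablePredTWt : DecidablePred TWt :=
  fun _ => inferInstanceAs (Decidable (_ ∨ _))

/-- Membership in `U`, unfolded. [cite: AbramovichTemkinWlodarczyk2024, §5] -/
theorem mem_U {w : ℚ} : w ∈ U ↔ w = 35/6 ∨ w = 56/9 ∨ w = 7 ∨ w = 28/3 ∨ w = 14 := by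
  simp [U]

/-- A `T`-weight is one of: dense, or one of the five `U`-values (case split used throughout).
[cite: AbramovichTemkinWlodarczyk2024, §5] -/
theorem tWt_cases {x : ℚ} (hx : TWt x) :
    Dense x ∨ x = 35/6 ∨ x = 56/9 ∨ x = 7 ∨ x = 28/3 ∨ x = 14 := by
  rcases hx with h | h
  · exact Or.inl h
  · exact Or.inr (mem_U.mp h)

/-- Every `T`-weight is `≥ 5`. [cite: AbramovichTemkinWlodarczyk2024, §5] -/
theorem five_le_of_tWt {x : ℚ} (hx : TWt x) : 5 ≤ x := by
  rcases tWt_cases hx with ⟨h, -⟩ | h | h | h | h | h <;> linarith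

/-- A `T`-weight is either `≤ 28/5` or in `U`. [cite: AbramovichTemkinWlodarczyk2024, §5] -/
theorem le_or_mem_U_of_tWt {x : ℚ} (hx : TWt x) : x ≤ 28/5 ∨ x ∈ U := by
  rcases hx with ⟨-, h⟩ | h
  · exact Or.inl h
  · exact Or.inr h

/-- Above the dense range, legal means `∈ U`. [cite: AbramovichTemkinWlodarczyk2024, §5] -/
theorem legal_iff_mem_U_of_lt {w : ℚ} (h : 28/5 < w) : Legal w ↔ w ∈ U := by
  constructor
  · rintro (⟨-, h'⟩ | h')
    · exfalso; linarith
    · exact h'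
  · exact Or.inr

/-- From weight `10` on, the only legal weight is `14` (`V`).
[cite: AbramovichTemkinWlodarczyk2024, §5] -/
theorem legal_iff_eq_fourteen_of_le {w : ℚ} (h : 10 ≤ w) : Legal w ↔ w = 14 := by
  rw [legal_iff_mem_U_of_lt (by linarith), mem_U]
  constructor
  · rintro (h' | h' | h' | h' | h') <;> linarith
  · intro h'; exact Or.inr (Or.inr (Or.inr (Or.inr h')))

/-! ## PART 2(a): the suppliers -/

/-- **One `T`-part.** For a `T`-weight `x` and order `s ∈ {1, …, 5}`: `x + s` is legal iff
`(s, x) ∈ {(1, 47/9), (2, 5), (4, 16/3)}` — the supplier kinds `N'(1;x₄₇)` (slot `56/9 = N'`),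
`W(2;F)` (slot `7 = W`), `M(4;x₁₆)` (slot `28/3 = M`); orders `3` and `5` have none.
[cite: AbramovichTemkinWlodarczyk2024, §5] -/
theorem onePart_census (x : ℚ) (hx : TWt x) :
    (Legal (x + 1) ↔ x = 47/9) ∧ (Legal (x + 2) ↔ x = 5) ∧ ¬ Legal (x + 3) ∧
      (Legal (x + 4) ↔ x = 16/3) ∧ ¬ Legal (x + 5) := by
  have h5 := five_le_of_tWt hx
  rw [legal_iff_mem_U_of_lt (by linarith), legal_iff_mem_U_of_lt (by linarith),
    legal_iff_mem_U_of_lt (by linarith), legal_iff_mem_U_of_lt (by linarith),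
    legal_iff_mem_U_of_lt (by linarith), mem_U, mem_U, mem_U, mem_U, mem_U]
  rcases tWt_cases hx with ⟨-, h⟩ | rfl | rfl | rfl | rfl | rfl
  · refine ⟨⟨?_, ?_⟩, ⟨?_, ?_⟩, ?_, ⟨?_, ?_⟩, ?_⟩
    · rintro (h' | h' | h' | h' | h') <;> linarith
    · rintro rfl; norm_num
    · rintro (h' | h' | h' | h' | h') <;> linarith
    · rintro rfl; norm_num
    · rintro (h' | h' | h' | h' | h') <;> linarith
    · rintro (h' | h' | h' | h' | h') <;> linarith
    · rintro rfl; norm_num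
    · rintro (h' | h' | h' | h' | h') <;> linarith
  all_goals norm_num

/-- **Two `T`-parts: the slot is `V`.** For `T`-weights `x, y` and `s ≥ 0`, `x + y + s` is legal
iff it equals `14`. [cite: AbramovichTemkinWlodarczyk2024, §5] -/
theorem legal_twoParts_iff (x y s : ℚ) (hx : TWt x) (hy : TWt y) (hs : 0 ≤ s) :
    Legal (x + y + s) ↔ x + y + s = 14 :=
  legal_iff_eq_fourteen_of_le (by linarith [five_le_of_tWt hx, five_le_of_tWt hy])

/-- **Two `T`-parts: the pair sums.** For `T`-weights `x ≤ y`: `x + y = 13` never; `= 12` iff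
`(x, y) = (5, 7)` (`V(2;FW)`); `= 11` iff both dense with `27/5 ≤ x ≤ 11/2`, `y = 11 − x`
(`V(3;xx')`) or `(x, y) = (31/6, 35/6)` (`V(3;N x₃₁)`); `= 10` iff `(x, y) = (5, 5)` (`V(4;FF)`);
`= 9` never (no supplier of order `5`). [cite: AbramovichTemkinWlodarczyk2024, §5] -/
theorem pairSum_census (x y : ℚ) (hx : TWt x) (hy : TWt y) (hxy : x ≤ y) :
    ¬ (x + y = 13) ∧ (x + y = 12 ↔ x = 5 ∧ y = 7) ∧
      (x + y = 11 ↔ (27/5 ≤ x ∧ x ≤ 11/2 ∧ y = 11 - x) ∨ (x = 31/6 ∧ y = 35/6)) ∧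
      (x + y = 10 ↔ x = 5 ∧ y = 5) ∧ ¬ (x + y = 9) := by
  have hx5 := five_le_of_tWt hx
  have hy5 := five_le_of_tWt hy
  rcases tWt_cases hx with ⟨-, hxd⟩ | rfl | rfl | rfl | rfl | rfl <;>
    rcases tWt_cases hy with ⟨-, hyd⟩ | rfl | rfl | rfl | rfl | rfl
  -- `x`, `y` both dense
  · refine ⟨by intro h; linarith, ⟨fun h => by exfalso; linarith, fun ⟨h1, h2⟩ => by linarith⟩,
      ⟨fun h => Or.inl ⟨by linarith, by linarith, by linarith⟩, ?_⟩,
      ⟨fun h => ⟨by linarith, by linarith⟩, fun ⟨h1, h2⟩ => by linarith⟩, by intro h; linarith⟩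
    rintro (⟨h1, h2, h3⟩ | ⟨h1, h2⟩) <;> linarith
  -- `x` dense, `y ∈ U`
  · refine ⟨by intro h; linarith, ⟨fun h => by exfalso; linarith, fun ⟨h1, h2⟩ => by linarith⟩,
      ⟨fun h => Or.inr ⟨by linarith, rfl⟩, ?_⟩,
      ⟨fun h => by exfalso; linarith, fun ⟨h1, h2⟩ => by linarith⟩, by intro h; linarith⟩
    rintro (⟨h1, h2, h3⟩ | ⟨h1, h2⟩) <;> linarith
  · refine ⟨by intro h; linarith, ⟨fun h => by exfalso; linarith, fun ⟨h1, h2⟩ => by linarith⟩,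
      ⟨fun h => by exfalso; linarith, ?_⟩,
      ⟨fun h => by exfalso; linarith, fun ⟨h1, h2⟩ => by linarith⟩, by intro h; linarith⟩
    rintro (⟨h1, h2, h3⟩ | ⟨h1, h2⟩) <;> linarith
  · refine ⟨by intro h; linarith, ⟨fun h => ⟨by linarith, rfl⟩, fun ⟨h1, h2⟩ => by linarith⟩,
      ⟨fun h => by exfalso; linarith, ?_⟩,
      ⟨fun h => by exfalso; linarith, fun ⟨h1, h2⟩ => by linarith⟩, by intro h; linarith⟩
    rintro (⟨h1, h2, h3⟩ | ⟨h1, h2⟩) <;> linarith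
  · refine ⟨by intro h; linarith, ⟨fun h => by exfalso; linarith, fun ⟨h1, h2⟩ => by linarith⟩,
      ⟨fun h => by exfalso; linarith, ?_⟩,
      ⟨fun h => by exfalso; linarith, fun ⟨h1, h2⟩ => by linarith⟩, by intro h; linarith⟩
    rintro (⟨h1, h2, h3⟩ | ⟨h1, h2⟩) <;> linarith
  · refine ⟨by intro h; linarith, ⟨fun h => by exfalso; linarith, fun ⟨h1, h2⟩ => by linarith⟩,
      ⟨fun h => by exfalso; linarith, ?_⟩,
      ⟨fun h => by exfalso; linarith, fun ⟨h1, h2⟩ => by linarith⟩, by intro h; linarith⟩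
    rintro (⟨h1, h2, h3⟩ | ⟨h1, h2⟩) <;> linarith
  -- `x ∈ U`: then `y ≥ x > 28/5`; with `y` dense this is impossible
  any_goals (exfalso; linarith)
  -- `x ∈ U`, `y ∈ U`: closed arithmetic
  all_goals norm_num

/-- **Three `T`-parts: none.** `x + y + z + s ≥ 15 > 14` is never legal (`s ≥ 0`).
[cite: AbramovichTemkinWlodarczyk2024, §5] -/
theorem not_legal_threeParts (x y z s : ℚ) (hx : TWt x) (hy : TWt y) (hz : TWt z) (hs : 0 ≤ s) :
    ¬ Legal (x + y + z + s) := by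
  have := five_le_of_tWt hx; have := five_le_of_tWt hy; have := five_le_of_tWt hz
  rw [legal_iff_eq_fourteen_of_le (by linarith)]
  intro h; linarith

/-- **No supplier of order `5`** (one or two parts; three parts never): a `V`-slot would need
`wt κ = 9`. [cite: AbramovichTemkinWlodarczyk2024, §5] -/
theorem no_supplier_order_five (x y : ℚ) (hx : TWt x) (hy : TWt y) :
    ¬ Legal (x + 5) ∧ ¬ Legal (x + y + 5) := by
  refine ⟨(onePart_census x hx).2.2.2.2, ?_⟩
  rw [legal_twoParts_iff x y 5 hx hy (by norm_num)]
  have := five_le_of_tWt hx; have := five_le_of_tWt hy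
  intro h; linarith

/-! ## PART 2(b): representability of the kept weight and the active sets -/

/-- `q` is representable by `T`-parts: `q` is the total weight of a (possibly empty) list of
`T`-variables. [cite: AbramovichTemkinWlodarczyk2024, §5] -/
def Representable (q : ℚ) : Prop := ∃ l : List ℚ, (∀ x ∈ l, TWt x) ∧ l.sum = q

/-- `0` is representable (empty product). [cite: AbramovichTemkinWlodarczyk2024, §5] -/
theorem repr_zero : Representable 0 := ⟨[], by simp, rfl⟩

/-- A `T`-weight is representable. [cite: AbramovichTemkinWlodarczyk2024, §5] -/
theorem repr_of_tWt {q : ℚ} (h : TWt q) : Representable q := ⟨[q], by simpa using h, by simp⟩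

/-- Representable weights add. [cite: AbramovichTemkinWlodarczyk2024, §5] -/
theorem Representable.add {a b : ℚ} (ha : Representable a) (hb : Representable b) : Representable (a + b) := by
  obtain ⟨l, hl, rfl⟩ := ha
  obtain ⟨m, hm, rfl⟩ := hb
  refine ⟨l ++ m, fun x hx => ?_, by simp⟩
  rcases List.mem_append.mp hx with h | h
  · exact hl x h
  · exact hm x h

/-- A list of `T`-weights has sum `≥ 5 · length`. [cite: AbramovichTemkinWlodarczyk2024, §5] -/
theorem five_mul_length_le_sum (l : List ℚ) (hl : ∀ x ∈ l, TWt x) :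
    5 * (l.length : ℚ) ≤ l.sum := by
  induction l with
  | nil => simp
  | cons a l ih =>
    have ha := five_le_of_tWt (hl a (by simp))
    have := ih fun x hx => hl x (by simp [hx])
    simp only [List.length_cons, Nat.cast_succ, List.sum_cons]
    linarith

/-- A negative weight is not representable. [cite: AbramovichTemkinWlodarczyk2024, §5] -/
theorem not_repr_of_neg {q : ℚ} (h : q < 0) : ¬ Representable q := by
  rintro ⟨l, hl, rfl⟩
  have := five_mul_length_le_sum l hl
  have : (0 : ℚ) ≤ l.length := by positivity
  linarith

/-- A weight in `(0, 5)` is not representable. [cite: AbramovichTemkinWlodarczyk2024, §5] -/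
theorem not_repr_of_pos_of_lt_five {q : ℚ} (h0 : 0 < q) (h5 : q < 5) : ¬ Representable q := by
  rintro ⟨l, hl, rfl⟩
  have := five_mul_length_le_sum l hl
  cases l with
  | nil => simp at h0
  | cons a l =>
    have : (1 : ℚ) ≤ (a :: l).length := by simp
    linarith

/-- A weight in `(28/5, 10)` outside `U` is not representable (one part would be the weight
itself; two parts weigh `≥ 10`). [cite: AbramovichTemkinWlodarczyk2024, §5] -/
theorem not_repr_of_gap {q : ℚ} (h1 : 28/5 < q) (h2 : q < 10) (hU : q ∉ U) : ¬ Representable q := by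
  rintro ⟨l, hl, rfl⟩
  match l, hl with
  | [], _ => simp at h1; linarith
  | [a], hl =>
    have ha : TWt a := hl a (by simp)
    simp only [List.sum_cons, List.sum_nil, add_zero] at h1 h2 hU
    rcases ha with ⟨-, h⟩ | h
    · linarith
    · exact hU h
  | a :: b :: l, hl =>
    have := five_mul_length_le_sum (a :: b :: l) hl
    have : (2 : ℚ) ≤ (a :: b :: l).length := by simp; norm_cast; omega
    linarith

/-- `7 = W` is representable. [cite: AbramovichTemkinWlodarczyk2024, §5] -/
theorem repr_seven : Representable 7 := repr_of_tWt (Or.inr (by norm_num [mem_U]))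

/-- `112/9 = N' + N'` (also `W + x`, `x = 49/9`) is representable.
[cite: AbramovichTemkinWlodarczyk2024, §5] -/
theorem repr_112 : Representable (112/9) := by
  have h : Representable (56/9) := repr_of_tWt (Or.inr (by norm_num [mem_U]))
  have := h.add h
  norm_num at this
  exact this

/-- `160/9 = N' + N' + x₁₆` (also `W + x + x'`) is representable.
[cite: AbramovichTemkinWlodarczyk2024, §5] -/
theorem repr_160 : Representable (160/9) := by
  have h : Representable (16/3) := repr_of_tWt (Or.inl ⟨by norm_num, by norm_num⟩)
  have := repr_112.add h
  norm_num at this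
  exact this

/-- `70/9` (left by `{N'(1;·), V(4;FF)}` and by `{W, W, N'}`) is not representable.
[cite: AbramovichTemkinWlodarczyk2024, §5] -/
theorem not_repr_70 : ¬ Representable (70/9) :=
  not_repr_of_gap (by norm_num) (by norm_num) (by norm_num [mem_U])

/-- The member kinds of an active set at `(5, 1/28)`: the seven supplier kinds of PART 2(a) and
the unrectified pure class `a₁` (order `4`, weight `4`).
[cite: AbramovichTemkinWlodarczyk2024, §5] -/
inductive Kind
  /-- `N'(1; x₄₇)`: slot `N' = 56/9`, order `1`, output `x₄₇ = 47/9` -/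
  | Np1x47
  /-- `W(2; F)`: slot `W = 7`, order `2`, output `F = 5` -/
  | W2F
  /-- `V(2; F W)`: slot `V = 14`, order `2`, output `F · W` -/
  | V2FW
  /-- `V(3; x x')`: slot `V = 14`, order `3`, output two dense parts, `x + x' = 11` -/
  | V3xx
  /-- `V(3; N x₃₁)`: slot `V = 14`, order `3`, output `N · x₃₁`, `35/6 + 31/6 = 11` -/
  | V3Nx31
  /-- `M(4; x₁₆)`: slot `M = 28/3`, order `4`, output `x₁₆ = 16/3` -/
  | M4x16
  /-- `V(4; F F)`: slot `V = 14`, order `4`, output `F · F` -/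
  | V4FF
  /-- the unrectified pure class `a₁`: weight `4`, order `4` (pure) -/
  | A1
  deriving DecidableEq

namespace Kind

/-- Slot weight of a member kind (times `28`). [cite: AbramovichTemkinWlodarczyk2024, §5] -/
def w : Kind → ℚ
  | Np1x47 => 56/9 | W2F => 7 | V2FW => 14 | V3xx => 14 | V3Nx31 => 14 | M4x16 => 28/3
  | V4FF => 14 | A1 => 4

/-- Order in `σ` of a member kind. [cite: AbramovichTemkinWlodarczyk2024, §5] -/
def s : Kind → ℕ
  | Np1x47 => 1 | W2F => 2 | V2FW => 2 | V3xx => 3 | V3Nx31 => 3 | M4x16 => 4 | V4FF => 4 | A1 => 4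

/-- Impure (a supplier) or pure (`a₁`). [cite: AbramovichTemkinWlodarczyk2024, §5] -/
def impure : Kind → Bool
  | A1 => false | _ => true

/-- The CLEAN kinds of §11.3: `N'(1;x₄₇)`, `W(2;F)`, `V(2;FW)`.
[cite: AbramovichTemkinWlodarczyk2024, §5] -/
def clean : Kind → Bool
  | Np1x47 => true | W2F => true | V2FW => true | _ => false

end Kind

/-- All eight kinds, in a fixed order. [cite: AbramovichTemkinWlodarczyk2024, §5] -/
def allKinds : List Kind := [.Np1x47, .W2F, .V2FW, .V3xx, .V3Nx31, .M4x16, .V4FF, .A1]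

/-- `allKinds` is exhaustive. [cite: AbramovichTemkinWlodarczyk2024, §5] -/
theorem mem_allKinds (k : Kind) : k ∈ allKinds := by cases k <;> decide

/-- The supplier kinds have exactly the `(slot weight, order)` data of PART 2(a): each is a legal
supplier in the sense of `onePart_census` / `pairSum_census` (closed arithmetic check of the seven
rows). [cite: AbramovichTemkinWlodarczyk2024, §5] -/
theorem kinds_match_partA :
    Kind.Np1x47.w = 47/9 + 1 ∧ Kind.W2F.w = 5 + 2 ∧ Kind.V2FW.w = 5 + 7 + 2 ∧
      Kind.V3Nx31.w = 35/6 + 31/6 + 3 ∧ Kind.M4x16.w = 16/3 + 4 ∧ Kind.V4FF.w = 5 + 5 + 4 ∧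
      (∀ x : ℚ, Kind.V3xx.w = x + (11 - x) + 3) ∧
      (∀ k : Kind, k.impure = true → Legal k.w) := by
  refine ⟨by norm_num [Kind.w], by norm_num [Kind.w], by norm_num [Kind.w], by norm_num [Kind.w],
    by norm_num [Kind.w], by norm_num [Kind.w], fun x => by show (14 : ℚ) = x + (11 - x) + 3; ring, ?_⟩
  intro k hk; cases k <;> simp_all [Kind.impure, Kind.w, Legal, mem_U]

/-- All multisets of size `d` over a list, each once, as index-nondecreasing lists
(`itertools.combinations_with_replacement`). [cite: AbramovichTemkinWlodarczyk2024, §5] -/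
def msets : ℕ → List Kind → List (List Kind)
  | 0, _ => [[]]
  | d + 1, ks => ks.tails.flatMap fun tl =>
      match tl with
      | [] => []
      | k :: _ => (msets d tl).map (k :: ·)

/-- Total order in `σ` of a multiset of members. [cite: AbramovichTemkinWlodarczyk2024, §5] -/
def ordSum (A : List Kind) : ℕ := (A.map Kind.s).sum

/-- Total slot weight of a multiset of members. [cite: AbramovichTemkinWlodarczyk2024, §5] -/
def wSum (A : List Kind) : ℚ := (A.map Kind.w).sum

/-- The CANDIDATE sets: multisets of members (size `≤ 5`) with orders summing to `p = 5` and at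
least one impure member. [cite: AbramovichTemkinWlodarczyk2024, §5] -/
def candidates : List (List Kind) :=
  ((List.range 6).flatMap fun d => msets d allKinds).filter
    fun A => ordSum A == 5 && A.any Kind.impure

/-- The `15` candidate sets, computed (every multiset with order sum `5` contains an impure
member, since `a₁` alone has order `4`). [cite: AbramovichTemkinWlodarczyk2024, §5] -/
theorem candidates_eq : candidates =
    [[.Np1x47, .M4x16], [.Np1x47, .V4FF], [.Np1x47, .A1], [.W2F, .V3xx], [.W2F, .V3Nx31],
     [.V2FW, .V3xx], [.V2FW, .V3Nx31],
     [.Np1x47, .Np1x47, .V3xx], [.Np1x47, .Np1x47, .V3Nx31], [.Np1x47, .W2F, .W2F],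
     [.Np1x47, .W2F, .V2FW], [.Np1x47, .V2FW, .V2FW],
     [.Np1x47, .Np1x47, .Np1x47, .W2F], [.Np1x47, .Np1x47, .Np1x47, .V2FW],
     [.Np1x47, .Np1x47, .Np1x47, .Np1x47, .Np1x47]] := by
  decide +kernel

/-- The SIX active sets of §11.3. [cite: AbramovichTemkinWlodarczyk2024, §5] -/
def activeSix : List (List Kind) :=
  [[.Np1x47, .M4x16], [.Np1x47, .A1], [.W2F, .V3xx], [.W2F, .V3Nx31], [.V2FW, .V3xx],
   [.V2FW, .V3Nx31]]

/-- The kept weights, computed: the active six keep `112/9, 160/9, 7, 7, 0, 0`; the other nine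
keep `70/9`, `14/9`, `70/9`, `7/9`, or a negative weight, or `7/3`.
[cite: AbramovichTemkinWlodarczyk2024, §5] -/
theorem keptWeight_table : ∀ A ∈ candidates,
    (A ∈ activeSix ∧ (28 - wSum A = 0 ∨ 28 - wSum A = 7 ∨ 28 - wSum A = 112/9 ∨
      28 - wSum A = 160/9)) ∨
    (A ∉ activeSix ∧ (28 - wSum A < 0 ∨ (0 < 28 - wSum A ∧ 28 - wSum A < 5) ∨
      28 - wSum A = 70/9)) := by
  rw [candidates_eq]; decide +kernel

/-- **PART 2(b): the active sets.** Among the candidates, the kept weight `28 − Σ w` is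
representable by `T`-parts iff the set is one of the six active sets.
[cite: AbramovichTemkinWlodarczyk2024, §5] -/
theorem active_census (A : List Kind) (hA : A ∈ candidates) :
    Representable (28 - wSum A) ↔ A ∈ activeSix := by
  rcases keptWeight_table A hA with ⟨hmem, h⟩ | ⟨hmem, h⟩
  · refine iff_of_true ?_ hmem
    rcases h with h | h | h | h <;> rw [h]
    exacts [repr_zero, repr_seven, repr_112, repr_160]
  · refine iff_of_false ?_ hmem
    rcases h with h | ⟨h0, h5⟩ | h
    · exact not_repr_of_neg h
    · exact not_repr_of_pos_of_lt_five h0 h5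
    · rw [h]; exact not_repr_70

/-- **FACT A at the point.** Every active set contains a CLEAN kind (`N'(1;x₄₇)`, `W(2;F)` or
`V(2;FW)`). [cite: AbramovichTemkinWlodarczyk2024, §5] -/
theorem factA : ∀ A ∈ activeSix, ∃ m ∈ A, m.clean = true := by decide

/-- The active sets have exactly two members, one of order `≤ 2` (the clean one) — "three or more
members leave `< 5`". [cite: AbramovichTemkinWlodarczyk2024, §5] -/
theorem activeSix_shape : ∀ A ∈ activeSix, A.length = 2 ∧ ∃ m ∈ A, m.s ≤ 2 ∧ m.clean = true := by
  decide

end Point28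

end Literature.AlgebraicGeometry.Resolution.WeightedBlowup
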